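import Summits.BirchSwinnertonDyer.BirchSwinnertonDyer.Theorems.SignedLowerHalvesKobayashiMainConjectureSmallImageCMTransferRecordsA
import Summits.BirchSwinnertonDyer.BirchSwinnertonDyer.Theorems.SignedLowerHalvesSprungLowerHalfAtThreeCMTransferRecords
import HarnessLib

/-!
# Route `SignedLowerHalves`, crux `KobayashiMainConjectureSmallImage` (item stmt-BirchSwinnertonDyer-19002) —
# the CM-congruence transfer line (L4-CM), μ-BINDER records part 08: 4 pairs at `p = 3` (partners `[0,0,0,175,0]`, `[0,0,0,49,0]`, `[0,0,0,8575,0]`, `[0,0,0,98,0]`)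
# (cell `bsd-ssimc`, seat `bsd-ssimc-k3-c4` gen 2)

HONEST FRAMING: Kobayashi's signed main conjecture at a non-surjective (normaliser-of-non-split-Cartan) image is OPEN; nothing
here proves it for any class. Every record is CONDITIONAL on (1) the explicitly labelled OPEN binder
`CorpuzLei2025_signedMainConjecture_transfer_OPEN` (Corpuz–Lei arXiv:2508.09733, 2025, UNREFEREED preprint; hypothesis `hCL`,
never asserted), (2) PUBLISHED results BY NAME (`hPR` Pollack–Rubin 2004; `h5`/`h3` period units), and (3) a DISPLAYED
NON-KERNEL binder `hμ'` = unit content of Kobayashi's `L_p^±(E')` for the RANK-≥1 CM partner `E'` (a two-engine CERTIFICATE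
from kit j251201 — PARI `ellpadiclambdamu` and the cell's PARI-free modular-symbol engine — quoted per record; NOT the unit case
of part A). Shape = the tree's class consumer `kobayashiMainConjecture_of_cmPartner_of_transfer_OPEN` (p422273) instantiated
per pair with EVERYTHING ELSE DECIDED IN THE KERNEL: `p ∤ Δ` (both curves), `#Ẽ(𝔽_p) = #Ẽ'(𝔽_p)
= p + 1` (`a_p = 0` both), CM of `E'` (`j ∈ cmJInvariants`), and the congruence `E[p] ≃ E'[p]` by Fisher's Hesse pencils
(UNCONDITIONAL at `p = 3`: `threeCongruent_of_{hesse,dualHesse}Certificate_unconditional`, Fisher's `n = 3` facts PROVED in the tree; covariant identities by `norm_num`). The partners' kernel data (point count at `p`, `Δ ≠ 0`, Kraus minimality, CM by `j`) for `[0,0,0,49,0]`, `[0,0,0,98,0]`, `[0,0,0,175,0]`, `[0,0,0,8575,0]`  are decided in THIS file — except `[0,0,0,49,0]`'s point count / ellipticity / minimality, which are ALREADY in the tree (k3-c5's `SignedLowerHalvesSprungLowerHalfAtThreeCMTransferRecords`: `card_cm49_3`, `isElliptic_cm49`, `isGloballyMinimal_cm49`, imported and reused; only its CM lemma `hasCM_cmp49_0`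 is added here). The window curves' own ellipticity / minimality enter only as instance binders (Cremona models). Pairs: `410816bj1 @ 3` (r_an 0), `288512n1 @ 3` (r_an 0), `431200dl1 @ 3` (r_an 0), `431200cv1 @ 3` (r_an 0). Per pair; item 4 stays OPEN; nothing is booked; BSD is not proved by any of this.

References: [CorpuzLei2025] Thms 1–3; [PollackRubin2004] Thm. (p. 448); [Kobayashi2003] Conj. (p. 2); [GreenbergVatsal2000] (2),
§3 Rem. 3.4; [Fisher2012Hessian] §8, §13, Thm. 13.2; [Fisher2013QuinticTwists] Thm. 5.8; [SilvermanAEC2009] III §1, VII.1, App. C §11;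
[Cremona2006] Table 1.
-/

set_option autoImplicit false
set_option linter.dupNamespace false

noncomputable section

open scoped Classical MatrixGroups ModularForm

open CongruenceSubgroup WeierstrassCurve Literature.NumberTheory.EllipticCurves
  Literature.NumberTheory.EllipticCurves.ModularForms
  Literature.NumberTheory.EllipticCurves.Kobayashi2003 ZpExtension
  Literature.NumberTheory.EllipticCurves.GreenbergVatsal2000
  Literature.NumberTheory.EllipticCurves.Rank1Residual
  Literature.NumberTheory.EllipticCurves.Rank1Residual.Typed
  Literature.NumberTheory.EllipticCurves.Rank1Residual.X11RankOneCertificates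
  Literature.NumberTheory.EllipticCurves.Fisher2012
  Summit.BirchSwinnertonDyer.BirchSwinnertonDyer.Rank1Residual.IntModel
  Summit.BirchSwinnertonDyer.BirchSwinnertonDyer.Rank1Residual.X11RankOne
  Summit.BirchSwinnertonDyer.Rank1Residual.X11b
  Summit.BirchSwinnertonDyer.Rank1Residual.X9
  Summit.BirchSwinnertonDyer.Rank1Residual.X1
  Summit.BirchSwinnertonDyer.Rank1Residual.Supersingular

namespace Summit.BirchSwinnertonDyer.BirchSwinnertonDyer.Theorems

/-- The CM partner `[0,0,0,49,0] : y² = x³ + 49x` (`j = 1728`) has CM (`j = 1728 ∈` the thirteen CM values), for any globally minimal `A` with this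
integral model. [cite: SilvermanAEC2009, App. C §11] -/
theorem hasCM_cmp49_0 {A : WeierstrassCurve ℚ} [A.IsElliptic] [A.IsGloballyMinimal]
    (hIA : integralModelInt A = ⟨0, 0, 0, 49, 0⟩) : A.HasCM :=
  (hasCM_iff_j_mem_holds A).mpr (by rw [j_eq_of_intModel 0 0 0 49 0 hIA]; decide +kernel)

/-- `#{Ẽ'(𝔽_3)} = 4` for the CM partner `[0,0,0,98,0] : y² = x³ + 98x` (`j = 1728`) (`a_3 = 0`: good SUPERSINGULAR; kernel count). [folklore] -/
theorem card_cmp98_0_3 :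
    Nat.card (((⟨0, 0, 0, 98, 0⟩ : WeierstrassCurve ℤ).map
      (Int.castRingHom (ZMod 3))).toAffine.Point) = 4 := by
  rw [@WeierstrassCurve.natCard_point_eq_one_add_card (ZMod 3) (@ZMod.instField 3 ⟨by norm_num⟩) _ _ _
    (by decide +kernel), @card_sol_eq_sum_euler (ZMod 3) (@ZMod.instField 3 ⟨by norm_num⟩) _ _
    (by rw [ZMod.ringChar_zmod_n]; decide), ZMod.card]
  decide +kernel

/-- The CM partner `[0,0,0,98,0] : y² = x³ + 98x` (`j = 1728`) is an elliptic curve (`Δ ≠ 0`, kernel). [folklore] -/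
theorem isElliptic_cmp98_0 : (⟨0, 0, 0, 98, 0⟩ : WeierstrassCurve ℚ).IsElliptic :=
  isElliptic_of_discOf_ne_zero 0 0 0 98 0 (by decide +kernel)

/-- The CM partner `[0,0,0,98,0] : y² = x³ + 98x` (`j = 1728`) is globally minimal (Kraus' bounded criterion, kernel). [cite: SilvermanAEC2009, VII.1 Remark 1.1] -/
theorem isGloballyMinimal_cmp98_0 : (⟨0, 0, 0, 98, 0⟩ : WeierstrassCurve ℚ).IsGloballyMinimal :=
  isGloballyMinimal_of_krausCriterion_bounded₂ 0 0 0 98 0 (by decide +kernel) (by decide +kernel)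
    (by decide +kernel)

/-- The CM partner `[0,0,0,98,0] : y² = x³ + 98x` (`j = 1728`) has CM (`j = 1728 ∈` the thirteen CM values), for any globally minimal `A` with this
integral model. [cite: SilvermanAEC2009, App. C §11] -/
theorem hasCM_cmp98_0 {A : WeierstrassCurve ℚ} [A.IsElliptic] [A.IsGloballyMinimal]
    (hIA : integralModelInt A = ⟨0, 0, 0, 98, 0⟩) : A.HasCM :=
  (hasCM_iff_j_mem_holds A).mpr (by rw [j_eq_of_intModel 0 0 0 98 0 hIA]; decide +kernel)

/-- `#{Ẽ'(𝔽_3)} = 4` for the CM partner `[0,0,0,175,0] : y² = x³ + 175x` (`j = 1728`) (`a_3 = 0`: good SUPERSINGULAR; kernel count). [folklore] -/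
theorem card_cmp175_0_3 :
    Nat.card (((⟨0, 0, 0, 175, 0⟩ : WeierstrassCurve ℤ).map
      (Int.castRingHom (ZMod 3))).toAffine.Point) = 4 := by
  rw [@WeierstrassCurve.natCard_point_eq_one_add_card (ZMod 3) (@ZMod.instField 3 ⟨by norm_num⟩) _ _ _
    (by decide +kernel), @card_sol_eq_sum_euler (ZMod 3) (@ZMod.instField 3 ⟨by norm_num⟩) _ _
    (by rw [ZMod.ringChar_zmod_n]; decide), ZMod.card]
  decide +kernel

/-- The CM partner `[0,0,0,175,0] : y² = x³ + 175x` (`j = 1728`) is an elliptic curve (`Δ ≠ 0`, kernel). [folklore] -/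
theorem isElliptic_cmp175_0 : (⟨0, 0, 0, 175, 0⟩ : WeierstrassCurve ℚ).IsElliptic :=
  isElliptic_of_discOf_ne_zero 0 0 0 175 0 (by decide +kernel)

/-- The CM partner `[0,0,0,175,0] : y² = x³ + 175x` (`j = 1728`) is globally minimal (Kraus' bounded criterion, kernel). [cite: SilvermanAEC2009, VII.1 Remark 1.1] -/
theorem isGloballyMinimal_cmp175_0 : (⟨0, 0, 0, 175, 0⟩ : WeierstrassCurve ℚ).IsGloballyMinimal :=
  isGloballyMinimal_of_krausCriterion_bounded₂ 0 0 0 175 0 (by decide +kernel) (by decide +kernel)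
    (by decide +kernel)

/-- The CM partner `[0,0,0,175,0] : y² = x³ + 175x` (`j = 1728`) has CM (`j = 1728 ∈` the thirteen CM values), for any globally minimal `A` with this
integral model. [cite: SilvermanAEC2009, App. C §11] -/
theorem hasCM_cmp175_0 {A : WeierstrassCurve ℚ} [A.IsElliptic] [A.IsGloballyMinimal]
    (hIA : integralModelInt A = ⟨0, 0, 0, 175, 0⟩) : A.HasCM :=
  (hasCM_iff_j_mem_holds A).mpr (by rw [j_eq_of_intModel 0 0 0 175 0 hIA]; decide +kernel)

/-- `#{Ẽ'(𝔽_3)} = 4` for the CM partner `[0,0,0,8575,0] : y² = x³ + 8575x` (`j = 1728`) (`a_3 = 0`: good SUPERSINGULAR; kernel count). [folklore] -/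
theorem card_cmp8575_0_3 :
    Nat.card (((⟨0, 0, 0, 8575, 0⟩ : WeierstrassCurve ℤ).map
      (Int.castRingHom (ZMod 3))).toAffine.Point) = 4 := by
  rw [@WeierstrassCurve.natCard_point_eq_one_add_card (ZMod 3) (@ZMod.instField 3 ⟨by norm_num⟩) _ _ _
    (by decide +kernel), @card_sol_eq_sum_euler (ZMod 3) (@ZMod.instField 3 ⟨by norm_num⟩) _ _
    (by rw [ZMod.ringChar_zmod_n]; decide), ZMod.card]
  decide +kernel

/-- The CM partner `[0,0,0,8575,0] : y² = x³ + 8575x` (`j = 1728`) is an elliptic curve (`Δ ≠ 0`, kernel). [folklore] -/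
theorem isElliptic_cmp8575_0 : (⟨0, 0, 0, 8575, 0⟩ : WeierstrassCurve ℚ).IsElliptic :=
  isElliptic_of_discOf_ne_zero 0 0 0 8575 0 (by decide +kernel)

/-- The CM partner `[0,0,0,8575,0] : y² = x³ + 8575x` (`j = 1728`) is globally minimal (Kraus' bounded criterion, kernel). [cite: SilvermanAEC2009, VII.1 Remark 1.1] -/
theorem isGloballyMinimal_cmp8575_0 : (⟨0, 0, 0, 8575, 0⟩ : WeierstrassCurve ℚ).IsGloballyMinimal :=
  isGloballyMinimal_of_krausCriterion_bounded₂ 0 0 0 8575 0 (by decide +kernel) (by decide +kernel)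
    (by decide +kernel)

/-- The CM partner `[0,0,0,8575,0] : y² = x³ + 8575x` (`j = 1728`) has CM (`j = 1728 ∈` the thirteen CM values), for any globally minimal `A` with this
integral model. [cite: SilvermanAEC2009, App. C §11] -/
theorem hasCM_cmp8575_0 {A : WeierstrassCurve ℚ} [A.IsElliptic] [A.IsGloballyMinimal]
    (hIA : integralModelInt A = ⟨0, 0, 0, 8575, 0⟩) : A.HasCM :=
  (hasCM_iff_j_mem_holds A).mpr (by rw [j_eq_of_intModel 0 0 0 8575 0 hIA]; decide +kernel)

/-- `#{Ẽ(𝔽_3)} = 4` for the Cremona model of `410816bj1` (`a_3 = 0`: good SUPERSINGULAR; kernel count).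
[cite: Cremona2006, Table 1 (Cremona label 410816bj1)] -/
theorem card_c410816bj1_3 :
    Nat.card (((⟨0, 0, 0, 7252, 4472720⟩ : WeierstrassCurve ℤ).map
      (Int.castRingHom (ZMod 3))).toAffine.Point) = 4 := by
  rw [@WeierstrassCurve.natCard_point_eq_one_add_card (ZMod 3) (@ZMod.instField 3 ⟨by norm_num⟩) _ _ _
    (by decide +kernel), @card_sol_eq_sum_euler (ZMod 3) (@ZMod.instField 3 ⟨by norm_num⟩) _ _
    (by rw [ZMod.ringChar_zmod_n]; decide), ZMod.card]
  decide +kernel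

/-- **Kobayashi's ± main conjecture, BOTH signs, for `410816bj1 @ 3`** (Cremona model `[0, 0, 0, 7252, 4472720]`, `N = 410816 = 2⁶·7²·131`,
`r_an = 0`; item-4 pair: X7, `a_3 = 0`, image `3Nn`) **by CM-congruence transfer from the RANK-1 CM partner
`E' =` `[0,0,0,49,0] : y² = x³ + 49x` (`j = 1728`) (conductor `3136`), MODULO the OPEN binder `hCL` (Corpuz–Lei 2025, PRE) AND the displayed
`μ`-BINDER `hμ'`** (unit content of `L_p^±(E')` — NOT a kernel fact; certificate: kit j251201 — engine A PARI `ellpadiclambdamu(E',3) = [[3, 1], [0, 0]]`; engine B (cell's PARI-free modular-symbol engine) Mazur–Tate layers: even-Pollack-index top n=5 μ=0 λ−q=3, odd top n=4 μ=0 λ−q=1 — TWO engines agree μ^± = 0; partner conductor 3136, analytic rank 1). `E ≅_ℚ` the member `(λ:μ) = (-140:1)` of `X_{E'}(3)`, `u = 28` (`threeCongruent_of_hesseCertificate_unconditional`: `E[3] ≃ E'[3]` UNCONDITIONAL);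
covariant identities by `norm_num`. BY NAME: `hPR`, `h5`, `h3`. Kernel-decided (models as instance binders): `3 ∤ Δ` (both),
`#Ẽ(𝔽_3) = #Ẽ'(𝔽_3) = 4`, CM of `E'`. Per pair; item 4 stays OPEN; nothing booked.
[claim: CorpuzLei2025, status: under-review] [cite: PollackRubin2004, Theorem (p. 448) = Thm. 7.3]
[cite: Fisher2012Hessian, Thm. 13.2 (n = 3)] [cite: Cremona2006, Table 1 (Cremona label 410816bj1)] -/
theorem kobayashiMainConjecture_c410816bj1_3_of_mu_of_transfer_OPEN
    (hCL : CorpuzLei2025_signedMainConjecture_transfer_OPEN)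
    (hPR : PollackRubin2004.mainTheorem_signedCharIdeal_eq_of_cm)
    (h5 : realPeriodRat_eq_unit_mul_plusPeriod) (h3 : realPeriodRat_eq_unit_mul_plusPeriod_three)
    (W A : WeierstrassCurve ℚ) [W.IsElliptic] [W.IsGloballyMinimal] [A.IsElliptic] [A.IsGloballyMinimal]
    [Fact (Nat.Prime 3)] (hW : W = ⟨0, 0, 0, 7252, 4472720⟩) (hA : A = ⟨0, 0, 0, 49, 0⟩)
    (hμ' : ∀ [NeZero (A.conductorNorm ℤ)] (f' : CuspForm (Gamma0 (A.conductorNorm ℤ)) 2),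
      IsNewformOf A f' → ∀ (Lplus Lminus : IwasawaAlgebra 3), IsPollackPair f' 3 Lplus Lminus →
      ∀ ε : ℤˣ, HasUnitContent (kobayashiL ε Lplus Lminus)) (ε : ℤˣ) :
    KobayashiMainConjecture W 3 ε := by
  have hIW : integralModelInt W = ⟨0, 0, 0, 7252, 4472720⟩ :=
    integralModelInt_eq_of_map_eq _ (by rw [hW]; ext <;> simp [WeierstrassCurve.map])
  have hIA : integralModelInt A = ⟨0, 0, 0, 49, 0⟩ :=
    integralModelInt_eq_of_map_eq _ (by rw [hA]; ext <;> simp [WeierstrassCurve.map])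
  have hΔ : (⟨0, 0, 0, 7252, 4472720⟩ : WeierstrassCurve ℤ).Δ = discOf [0, 0, 0, 7252, 4472720] :=
    intCurve_Δ 0 0 0 7252 4472720
  have hΔA : (⟨0, 0, 0, 49, 0⟩ : WeierstrassCurve ℤ).Δ = discOf [0, 0, 0, 49, 0] :=
    intCurve_Δ 0 0 0 49 0
  have hgood : W.HasGoodReductionAtPrime 3 :=
    hasGoodReductionAtPrime_of_not_dvd W 3 (by rw [minimalDiscriminantInt_eq hIW, hΔ]; decide +kernel)
  have hgoodA : A.HasGoodReductionAtPrime 3 :=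
    hasGoodReductionAtPrime_of_not_dvd A 3 (by rw [minimalDiscriminantInt_eq hIA, hΔA]; decide +kernel)
  have hap : W.frobeniusTrace 3 = 0 := by rw [frobeniusTrace_eq hIW card_c410816bj1_3]; norm_num
  have hapA : A.frobeniusTrace 3 = 0 := by rw [frobeniusTrace_eq hIA card_cm49_3]; norm_num
  have hc4 : W.c₄ = (-348096 : ℚ) := by
    subst hW; norm_num [WeierstrassCurve.c₄, WeierstrassCurve.b₂, WeierstrassCurve.b₄]
  have hc6 : W.c₆ = (-3864430080 : ℚ) := by
    subst hW; norm_num [WeierstrassCurve.c₆, WeierstrassCurve.b₂, WeierstrassCurve.b₄, WeierstrassCurve.b₆]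
  have hc4A : A.c₄ = (-2352 : ℚ) := by
    subst hA; norm_num [WeierstrassCurve.c₄, WeierstrassCurve.b₂, WeierstrassCurve.b₄]
  have hc6A : A.c₆ = (0 : ℚ) := by
    subst hA; norm_num [WeierstrassCurve.c₆, WeierstrassCurve.b₂, WeierstrassCurve.b₄, WeierstrassCurve.b₆]
  have hiso := threeCongruent_of_hesseCertificate_unconditional A W (-140 : ℚ) 1 (28 : ℚ)
    (by norm_num) (by rw [hc4A, hc6A, hc4, eval_hesseC4three]; norm_num)
    (by rw [hc4A, hc6A, hc6, eval_hesseC6three]; norm_num)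
  exact kobayashiMainConjecture_of_cmPartner_of_transfer_OPEN W A 3 hCL hPR h5 h3 (by norm_num) hgood hap
    (hasCM_cmp49_0 hIA) ⟨hgoodA, by rw [hapA]; exact dvd_zero _⟩ hapA hiso hμ' ε

/-- `#{Ẽ(𝔽_3)} = 4` for the Cremona model of `288512n1` (`a_3 = 0`: good SUPERSINGULAR; kernel count).
[cite: Cremona2006, Table 1 (Cremona label 288512n1)] -/
theorem card_c288512n1_3 :
    Nat.card (((⟨0, 0, 0, -1589854, 771585360⟩ : WeierstrassCurve ℤ).map
      (Int.castRingHom (ZMod 3))).toAffine.Point) = 4 := by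
  rw [@WeierstrassCurve.natCard_point_eq_one_add_card (ZMod 3) (@ZMod.instField 3 ⟨by norm_num⟩) _ _ _
    (by decide +kernel), @card_sol_eq_sum_euler (ZMod 3) (@ZMod.instField 3 ⟨by norm_num⟩) _ _
    (by rw [ZMod.ringChar_zmod_n]; decide), ZMod.card]
  decide +kernel

/-- **Kobayashi's ± main conjecture, BOTH signs, for `288512n1 @ 3`** (Cremona model `[0, 0, 0, -1589854, 771585360]`, `N = 288512 = 2⁸·7²·23`,
`r_an = 0`; item-4 pair: X7, `a_3 = 0`, image `3Nn`) **by CM-congruence transfer from the RANK-1 CM partner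
`E' =` `[0,0,0,98,0] : y² = x³ + 98x` (`j = 1728`) (conductor `12544`), MODULO the OPEN binder `hCL` (Corpuz–Lei 2025, PRE) AND the displayed
`μ`-BINDER `hμ'`** (unit content of `L_p^±(E')` — NOT a kernel fact; certificate: kit j251201 — engine A PARI `ellpadiclambdamu(E',3) = [[3, 7], [0, 0]]`; engine B (cell's PARI-free modular-symbol engine) Mazur–Tate layers: even-Pollack-index top n=5 μ=0 λ−q=3, odd top n=4 μ=0 λ−q=7 — TWO engines agree μ^± = 0; partner conductor 12544, analytic rank 1). `E ≅_ℚ` the member `(λ:μ) = (-140:3)` of `X_{E'}(3)`, `u = 28/3` (`threeCongruent_of_hesseCertificate_unconditional`: `E[3] ≃ E'[3]` UNCONDITIONAL);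
covariant identities by `norm_num`. BY NAME: `hPR`, `h5`, `h3`. Kernel-decided (models as instance binders): `3 ∤ Δ` (both),
`#Ẽ(𝔽_3) = #Ẽ'(𝔽_3) = 4`, CM of `E'`. Per pair; item 4 stays OPEN; nothing booked.
[claim: CorpuzLei2025, status: under-review] [cite: PollackRubin2004, Theorem (p. 448) = Thm. 7.3]
[cite: Fisher2012Hessian, Thm. 13.2 (n = 3)] [cite: Cremona2006, Table 1 (Cremona label 288512n1)] -/
theorem kobayashiMainConjecture_c288512n1_3_of_mu_of_transfer_OPEN
    (hCL : CorpuzLei2025_signedMainConjecture_transfer_OPEN)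
    (hPR : PollackRubin2004.mainTheorem_signedCharIdeal_eq_of_cm)
    (h5 : realPeriodRat_eq_unit_mul_plusPeriod) (h3 : realPeriodRat_eq_unit_mul_plusPeriod_three)
    (W A : WeierstrassCurve ℚ) [W.IsElliptic] [W.IsGloballyMinimal] [A.IsElliptic] [A.IsGloballyMinimal]
    [Fact (Nat.Prime 3)] (hW : W = ⟨0, 0, 0, -1589854, 771585360⟩) (hA : A = ⟨0, 0, 0, 98, 0⟩)
    (hμ' : ∀ [NeZero (A.conductorNorm ℤ)] (f' : CuspForm (Gamma0 (A.conductorNorm ℤ)) 2),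
      IsNewformOf A f' → ∀ (Lplus Lminus : IwasawaAlgebra 3), IsPollackPair f' 3 Lplus Lminus →
      ∀ ε : ℤˣ, HasUnitContent (kobayashiL ε Lplus Lminus)) (ε : ℤˣ) :
    KobayashiMainConjecture W 3 ε := by
  have hIW : integralModelInt W = ⟨0, 0, 0, -1589854, 771585360⟩ :=
    integralModelInt_eq_of_map_eq _ (by rw [hW]; ext <;> simp [WeierstrassCurve.map])
  have hIA : integralModelInt A = ⟨0, 0, 0, 98, 0⟩ :=
    integralModelInt_eq_of_map_eq _ (by rw [hA]; ext <;> simp [WeierstrassCurve.map])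
  have hΔ : (⟨0, 0, 0, -1589854, 771585360⟩ : WeierstrassCurve ℤ).Δ = discOf [0, 0, 0, -1589854, 771585360] :=
    intCurve_Δ 0 0 0 (-1589854) 771585360
  have hΔA : (⟨0, 0, 0, 98, 0⟩ : WeierstrassCurve ℤ).Δ = discOf [0, 0, 0, 98, 0] :=
    intCurve_Δ 0 0 0 98 0
  have hgood : W.HasGoodReductionAtPrime 3 :=
    hasGoodReductionAtPrime_of_not_dvd W 3 (by rw [minimalDiscriminantInt_eq hIW, hΔ]; decide +kernel)
  have hgoodA : A.HasGoodReductionAtPrime 3 :=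
    hasGoodReductionAtPrime_of_not_dvd A 3 (by rw [minimalDiscriminantInt_eq hIA, hΔA]; decide +kernel)
  have hap : W.frobeniusTrace 3 = 0 := by rw [frobeniusTrace_eq hIW card_c288512n1_3]; norm_num
  have hapA : A.frobeniusTrace 3 = 0 := by rw [frobeniusTrace_eq hIA card_cmp98_0_3]; norm_num
  have hc4 : W.c₄ = (76312992 : ℚ) := by
    subst hW; norm_num [WeierstrassCurve.c₄, WeierstrassCurve.b₂, WeierstrassCurve.b₄]
  have hc6 : W.c₆ = (-666649751040 : ℚ) := by
    subst hW; norm_num [WeierstrassCurve.c₆, WeierstrassCurve.b₂, WeierstrassCurve.b₄, WeierstrassCurve.b₆]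
  have hc4A : A.c₄ = (-4704 : ℚ) := by
    subst hA; norm_num [WeierstrassCurve.c₄, WeierstrassCurve.b₂, WeierstrassCurve.b₄]
  have hc6A : A.c₆ = (0 : ℚ) := by
    subst hA; norm_num [WeierstrassCurve.c₆, WeierstrassCurve.b₂, WeierstrassCurve.b₄, WeierstrassCurve.b₆]
  have hiso := threeCongruent_of_hesseCertificate_unconditional A W ((-140 : ℚ) / 3) 1 ((28 : ℚ) / 3)
    (by norm_num) (by rw [hc4A, hc6A, hc4, eval_hesseC4three]; norm_num)
    (by rw [hc4A, hc6A, hc6, eval_hesseC6three]; norm_num)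
  exact kobayashiMainConjecture_of_cmPartner_of_transfer_OPEN W A 3 hCL hPR h5 h3 (by norm_num) hgood hap
    (hasCM_cmp98_0 hIA) ⟨hgoodA, by rw [hapA]; exact dvd_zero _⟩ hapA hiso hμ' ε

/-- `#{Ẽ(𝔽_3)} = 4` for the Cremona model of `431200dl1` (`a_3 = 0`: good SUPERSINGULAR; kernel count).
[cite: Cremona2006, Table 1 (Cremona label 431200dl1)] -/
theorem card_c431200dl1_3 :
    Nat.card (((⟨0, 0, 0, -7606025, 8084167000⟩ : WeierstrassCurve ℤ).map
      (Int.castRingHom (ZMod 3))).toAffine.Point) = 4 := by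
  rw [@WeierstrassCurve.natCard_point_eq_one_add_card (ZMod 3) (@ZMod.instField 3 ⟨by norm_num⟩) _ _ _
    (by decide +kernel), @card_sol_eq_sum_euler (ZMod 3) (@ZMod.instField 3 ⟨by norm_num⟩) _ _
    (by rw [ZMod.ringChar_zmod_n]; decide), ZMod.card]
  decide +kernel

/-- **Kobayashi's ± main conjecture, BOTH signs, for `431200dl1 @ 3`** (Cremona model `[0, 0, 0, -7606025, 8084167000]`, `N = 431200 = 2⁵·5²·7²·11`,
`r_an = 0`; item-4 pair: X7, `a_3 = 0`, image `3Nn`) **by CM-congruence transfer from the RANK-1 CM partner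
`E' =` `[0,0,0,175,0] : y² = x³ + 175x` (`j = 1728`) (conductor `39200`), MODULO the OPEN binder `hCL` (Corpuz–Lei 2025, PRE) AND the displayed
`μ`-BINDER `hμ'`** (unit content of `L_p^±(E')` — NOT a kernel fact; certificate: kit j251201 — engine A `ellpadiclambdamu` infeasible at this conductor (PARI stack overflow at 14 GB); engine B (cell's PARI-free modular-symbol engine) Mazur–Tate layers: even-Pollack-index top n=5 μ=0 λ−q=1, odd top n=4 μ=0 λ−q=1 — «μ:one-engine» — ONE engine (B) reads μ^± = 0; partner conductor 39200, analytic rank 1). `E ≅_ℚ` the member `(λ:μ) = (-70:1)` of `X_{E'}(3)`, `u = 10` (`threeCongruent_of_hesseCertificate_unconditional`: `E[3] ≃ E'[3]` UNCONDITIONAL);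
covariant identities by `norm_num`. BY NAME: `hPR`, `h5`, `h3`. Kernel-decided (models as instance binders): `3 ∤ Δ` (both),
`#Ẽ(𝔽_3) = #Ẽ'(𝔽_3) = 4`, CM of `E'`. Per pair; item 4 stays OPEN; nothing booked.
[claim: CorpuzLei2025, status: under-review] [cite: PollackRubin2004, Theorem (p. 448) = Thm. 7.3]
[cite: Fisher2012Hessian, Thm. 13.2 (n = 3)] [cite: Cremona2006, Table 1 (Cremona label 431200dl1)] -/
theorem kobayashiMainConjecture_c431200dl1_3_of_mu_of_transfer_OPEN
    (hCL : CorpuzLei2025_signedMainConjecture_transfer_OPEN)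
    (hPR : PollackRubin2004.mainTheorem_signedCharIdeal_eq_of_cm)
    (h5 : realPeriodRat_eq_unit_mul_plusPeriod) (h3 : realPeriodRat_eq_unit_mul_plusPeriod_three)
    (W A : WeierstrassCurve ℚ) [W.IsElliptic] [W.IsGloballyMinimal] [A.IsElliptic] [A.IsGloballyMinimal]
    [Fact (Nat.Prime 3)] (hW : W = ⟨0, 0, 0, -7606025, 8084167000⟩) (hA : A = ⟨0, 0, 0, 175, 0⟩)
    (hμ' : ∀ [NeZero (A.conductorNorm ℤ)] (f' : CuspForm (Gamma0 (A.conductorNorm ℤ)) 2),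
      IsNewformOf A f' → ∀ (Lplus Lminus : IwasawaAlgebra 3), IsPollackPair f' 3 Lplus Lminus →
      ∀ ε : ℤˣ, HasUnitContent (kobayashiL ε Lplus Lminus)) (ε : ℤˣ) :
    KobayashiMainConjecture W 3 ε := by
  have hIW : integralModelInt W = ⟨0, 0, 0, -7606025, 8084167000⟩ :=
    integralModelInt_eq_of_map_eq _ (by rw [hW]; ext <;> simp [WeierstrassCurve.map])
  have hIA : integralModelInt A = ⟨0, 0, 0, 175, 0⟩ :=
    integralModelInt_eq_of_map_eq _ (by rw [hA]; ext <;> simp [WeierstrassCurve.map])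
  have hΔ : (⟨0, 0, 0, -7606025, 8084167000⟩ : WeierstrassCurve ℤ).Δ = discOf [0, 0, 0, -7606025, 8084167000] :=
    intCurve_Δ 0 0 0 (-7606025) 8084167000
  have hΔA : (⟨0, 0, 0, 175, 0⟩ : WeierstrassCurve ℤ).Δ = discOf [0, 0, 0, 175, 0] :=
    intCurve_Δ 0 0 0 175 0
  have hgood : W.HasGoodReductionAtPrime 3 :=
    hasGoodReductionAtPrime_of_not_dvd W 3 (by rw [minimalDiscriminantInt_eq hIW, hΔ]; decide +kernel)
  have hgoodA : A.HasGoodReductionAtPrime 3 :=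
    hasGoodReductionAtPrime_of_not_dvd A 3 (by rw [minimalDiscriminantInt_eq hIA, hΔA]; decide +kernel)
  have hap : W.frobeniusTrace 3 = 0 := by rw [frobeniusTrace_eq hIW card_c431200dl1_3]; norm_num
  have hapA : A.frobeniusTrace 3 = 0 := by rw [frobeniusTrace_eq hIA card_cmp175_0_3]; norm_num
  have hc4 : W.c₄ = (365089200 : ℚ) := by
    subst hW; norm_num [WeierstrassCurve.c₄, WeierstrassCurve.b₂, WeierstrassCurve.b₄]
  have hc6 : W.c₆ = (-6984720288000 : ℚ) := by
    subst hW; norm_num [WeierstrassCurve.c₆, WeierstrassCurve.b₂, WeierstrassCurve.b₄, WeierstrassCurve.b₆]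
  have hc4A : A.c₄ = (-8400 : ℚ) := by
    subst hA; norm_num [WeierstrassCurve.c₄, WeierstrassCurve.b₂, WeierstrassCurve.b₄]
  have hc6A : A.c₆ = (0 : ℚ) := by
    subst hA; norm_num [WeierstrassCurve.c₆, WeierstrassCurve.b₂, WeierstrassCurve.b₄, WeierstrassCurve.b₆]
  have hiso := threeCongruent_of_hesseCertificate_unconditional A W (-70 : ℚ) 1 (10 : ℚ)
    (by norm_num) (by rw [hc4A, hc6A, hc4, eval_hesseC4three]; norm_num)
    (by rw [hc4A, hc6A, hc6, eval_hesseC6three]; norm_num)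
  exact kobayashiMainConjecture_of_cmPartner_of_transfer_OPEN W A 3 hCL hPR h5 h3 (by norm_num) hgood hap
    (hasCM_cmp175_0 hIA) ⟨hgoodA, by rw [hapA]; exact dvd_zero _⟩ hapA hiso hμ' ε

/-- `#{Ẽ(𝔽_3)} = 4` for the Cremona model of `431200cv1` (`a_3 = 0`: good SUPERSINGULAR; kernel count).
[cite: Cremona2006, Table 1 (Cremona label 431200cv1)] -/
theorem card_c431200cv1_3 :
    Nat.card (((⟨0, 0, 0, -155225, -23569000⟩ : WeierstrassCurve ℤ).map
      (Int.castRingHom (ZMod 3))).toAffine.Point) = 4 := by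
  rw [@WeierstrassCurve.natCard_point_eq_one_add_card (ZMod 3) (@ZMod.instField 3 ⟨by norm_num⟩) _ _ _
    (by decide +kernel), @card_sol_eq_sum_euler (ZMod 3) (@ZMod.instField 3 ⟨by norm_num⟩) _ _
    (by rw [ZMod.ringChar_zmod_n]; decide), ZMod.card]
  decide +kernel

/-- **Kobayashi's ± main conjecture, BOTH signs, for `431200cv1 @ 3`** (Cremona model `[0, 0, 0, -155225, -23569000]`, `N = 431200 = 2⁵·5²·7²·11`,
`r_an = 0`; item-4 pair: X7, `a_3 = 0`, image `3Nn`) **by CM-congruence transfer from the RANK-1 CM partner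
`E' =` `[0,0,0,8575,0] : y² = x³ + 8575x` (`j = 1728`) (conductor `39200`), MODULO the OPEN binder `hCL` (Corpuz–Lei 2025, PRE) AND the displayed
`μ`-BINDER `hμ'`** (unit content of `L_p^±(E')` — NOT a kernel fact; certificate: kit j251201 — engine A `ellpadiclambdamu` infeasible at this conductor (PARI stack overflow at 14 GB); engine B (cell's PARI-free modular-symbol engine) Mazur–Tate layers: even-Pollack-index top n=5 μ=0 λ−q=1, odd top n=4 μ=0 λ−q=5 — «μ:one-engine» — ONE engine (B) reads μ^± = 0; partner conductor 39200, analytic rank 1). `E ≅_ℚ` the member `(λ:μ) = (490:1)` of `X_{E'}(3)`, `u = 490` (`threeCongruent_of_hesseCertificate_unconditional`: `E[3] ≃ E'[3]` UNCONDITIONAL);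
covariant identities by `norm_num`. BY NAME: `hPR`, `h5`, `h3`. Kernel-decided (models as instance binders): `3 ∤ Δ` (both),
`#Ẽ(𝔽_3) = #Ẽ'(𝔽_3) = 4`, CM of `E'`. Per pair; item 4 stays OPEN; nothing booked.
[claim: CorpuzLei2025, status: under-review] [cite: PollackRubin2004, Theorem (p. 448) = Thm. 7.3]
[cite: Fisher2012Hessian, Thm. 13.2 (n = 3)] [cite: Cremona2006, Table 1 (Cremona label 431200cv1)] -/
theorem kobayashiMainConjecture_c431200cv1_3_of_mu_of_transfer_OPEN
    (hCL : CorpuzLei2025_signedMainConjecture_transfer_OPEN)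
    (hPR : PollackRubin2004.mainTheorem_signedCharIdeal_eq_of_cm)
    (h5 : realPeriodRat_eq_unit_mul_plusPeriod) (h3 : realPeriodRat_eq_unit_mul_plusPeriod_three)
    (W A : WeierstrassCurve ℚ) [W.IsElliptic] [W.IsGloballyMinimal] [A.IsElliptic] [A.IsGloballyMinimal]
    [Fact (Nat.Prime 3)] (hW : W = ⟨0, 0, 0, -155225, -23569000⟩) (hA : A = ⟨0, 0, 0, 8575, 0⟩)
    (hμ' : ∀ [NeZero (A.conductorNorm ℤ)] (f' : CuspForm (Gamma0 (A.conductorNorm ℤ)) 2),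
      IsNewformOf A f' → ∀ (Lplus Lminus : IwasawaAlgebra 3), IsPollackPair f' 3 Lplus Lminus →
      ∀ ε : ℤˣ, HasUnitContent (kobayashiL ε Lplus Lminus)) (ε : ℤˣ) :
    KobayashiMainConjecture W 3 ε := by
  have hIW : integralModelInt W = ⟨0, 0, 0, -155225, -23569000⟩ :=
    integralModelInt_eq_of_map_eq _ (by rw [hW]; ext <;> simp [WeierstrassCurve.map])
  have hIA : integralModelInt A = ⟨0, 0, 0, 8575, 0⟩ :=
    integralModelInt_eq_of_map_eq _ (by rw [hA]; ext <;> simp [WeierstrassCurve.map])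
  have hΔ : (⟨0, 0, 0, -155225, -23569000⟩ : WeierstrassCurve ℤ).Δ = discOf [0, 0, 0, -155225, -23569000] :=
    intCurve_Δ 0 0 0 (-155225) (-23569000)
  have hΔA : (⟨0, 0, 0, 8575, 0⟩ : WeierstrassCurve ℤ).Δ = discOf [0, 0, 0, 8575, 0] :=
    intCurve_Δ 0 0 0 8575 0
  have hgood : W.HasGoodReductionAtPrime 3 :=
    hasGoodReductionAtPrime_of_not_dvd W 3 (by rw [minimalDiscriminantInt_eq hIW, hΔ]; decide +kernel)
  have hgoodA : A.HasGoodReductionAtPrime 3 :=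
    hasGoodReductionAtPrime_of_not_dvd A 3 (by rw [minimalDiscriminantInt_eq hIA, hΔA]; decide +kernel)
  have hap : W.frobeniusTrace 3 = 0 := by rw [frobeniusTrace_eq hIW card_c431200cv1_3]; norm_num
  have hapA : A.frobeniusTrace 3 = 0 := by rw [frobeniusTrace_eq hIA card_cmp8575_0_3]; norm_num
  have hc4 : W.c₄ = (7450800 : ℚ) := by
    subst hW; norm_num [WeierstrassCurve.c₄, WeierstrassCurve.b₂, WeierstrassCurve.b₄]
  have hc6 : W.c₆ = (20363616000 : ℚ) := by
    subst hW; norm_num [WeierstrassCurve.c₆, WeierstrassCurve.b₂, WeierstrassCurve.b₄, WeierstrassCurve.b₆]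
  have hc4A : A.c₄ = (-411600 : ℚ) := by
    subst hA; norm_num [WeierstrassCurve.c₄, WeierstrassCurve.b₂, WeierstrassCurve.b₄]
  have hc6A : A.c₆ = (0 : ℚ) := by
    subst hA; norm_num [WeierstrassCurve.c₆, WeierstrassCurve.b₂, WeierstrassCurve.b₄, WeierstrassCurve.b₆]
  have hiso := threeCongruent_of_hesseCertificate_unconditional A W (490 : ℚ) 1 (490 : ℚ)
    (by norm_num) (by rw [hc4A, hc6A, hc4, eval_hesseC4three]; norm_num)
    (by rw [hc4A, hc6A, hc6, eval_hesseC6three]; norm_num)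
  exact kobayashiMainConjecture_of_cmPartner_of_transfer_OPEN W A 3 hCL hPR h5 h3 (by norm_num) hgood hap
    (hasCM_cmp8575_0 hIA) ⟨hgoodA, by rw [hapA]; exact dvd_zero _⟩ hapA hiso hμ' ε

end Summit.BirchSwinnertonDyer.BirchSwinnertonDyer.Theorems

end
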